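import Literature.AlgebraicGeometry.Morphisms.CechModule
import Mathlib.Topology.Sheaves.SheafCondition.UniqueGluing
import HarnessLib

/-!
# Refinement maps on the Čech cochains of a sheaf of modules; injectivity of `Ȟ¹` under refinement

The module version of `Morphisms/CechH1Refinement` (which treats the structure sheaf): for a scheme
`f : X → Spec A`, a sheaf of `𝒪_X`-modules `M : X.Modules` and a map of families of opens
`τ : 𝒱 → 𝒰` (`V_j ⊆ U_{τ j}`; Görtz–Wedhorn II, (21.16), Def. 21.71; The Stacks Project, Tag 09UY):

* `MSections.eq_of_res_eq`, `MSections.exists_res_eq` — locality and gluing for the sections of `M`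
  (Mathlib's sheaf condition `TopCat.Sheaf.eq_of_locally_eq'`, `existsUnique_gluing'` for the
  underlying sheaf of abelian groups `M.presheaf`);
* `cechMRefineC0/C1` — `(ρ c)_{jj'} = c_{τ j, τ j'}|_{V_j ∩ V_{j'}}`, commuting with `d⁰`
  (`cechMD0_refineC0`), preserving cocycles and coboundaries;
* `mem_cechMB1_of_refineMC1_mem_cechMB1` — **if `𝒱` covers every `U_i` and the refinement of a
  cocycle `c` of `M` on `𝒰` is a coboundary on `𝒱`, then `c` is a coboundary on `𝒰`** (the cocycle
  form of the injectivity of `Ȟ¹(𝒰, M) → Ȟ¹(𝒱, M)`, Görtz–Wedhorn II, Cor. 21.81: glue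
  `b_i` from `e_j + c_{τ j, i}` on `U_i ∩ V_j`).

This is the reduction-to-a-principal-covering step of the vanishing of `Ȟ¹` of quasi-coherent modules
on affine opens (`Morphisms/CechModuleAffine`). Everything is proved; no named facts. Mathlib searched
(pin v4.32): `TopCat.Sheaf.existsUnique_gluing'`, `TopCat.Sheaf.eq_of_locally_eq'`,
`AlgebraicGeometry.Scheme.Modules.isSheaf` (used); no Čech refinement maps for sheaves of modules.

## References

* U. Görtz, T. Wedhorn, *Algebraic Geometry II: Cohomology of Schemes*, Springer Spektrum (2023),
  doi:10.1007/978-3-658-43031-3: (21.16), Def. 21.71 and Lemma 21.72, p. 262; Cor. 21.81, p. 265.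
  [GortzWedhorn2023]
* The Stacks Project, Tag 09UY (refinements and Čech cohomology), Tag 01ED. [StacksProject]
-/

noncomputable section

open CategoryTheory AlgebraicGeometry Limits TopologicalSpace Opposite

universe u v w

namespace Literature.AlgebraicGeometry.Morphisms

variable {A : Type u} [CommRing A] {X : Scheme.{u}} (f : X ⟶ Spec (.of A)) (M : X.Modules)

/-! ## Sheaf properties of `MSections` -/

namespace MSections

/-- The underlying sheaf of abelian groups of `M`. [folklore] -/
abbrev abSheaf (M : X.Modules) : TopCat.Sheaf Ab X := ⟨M.presheaf, M.isSheaf⟩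

/-- **Locality**: sections of `M` over `V` which agree on a family of opens `W_j ⊆ V` covering `V` are
equal. [folklore] -/
theorem eq_of_res_eq {V : X.Opens} {J : Type*} (W : J → X.Opens) (hW : ∀ j, W j ≤ V)
    (hcov : V ≤ ⨆ j, W j) {s t : MSections f M V}
    (h : ∀ j, MSections.res f M (hW j) s = MSections.res f M (hW j) t) : s = t :=
  (abSheaf M).eq_of_locally_eq' W V (fun j => homOfLE (hW j)) hcov s t h

/-- **Gluing**: sections `s_j` of `M` over opens `W_j ⊆ V` covering `V` which agree on the overlaps glue
to a section over `V`. [folklore] -/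
theorem exists_res_eq {V : X.Opens} {J : Type*} (W : J → X.Opens) (hW : ∀ j, W j ≤ V)
    (hcov : V ≤ ⨆ j, W j) (s : ∀ j, MSections f M (W j))
    (hs : ∀ j j', MSections.res f M (inf_le_left : W j ⊓ W j' ≤ W j) (s j) =
      MSections.res f M (inf_le_right : W j ⊓ W j' ≤ W j') (s j')) :
    ∃ t : MSections f M V, ∀ j, MSections.res f M (hW j) t = s j := by
  obtain ⟨t, ht, -⟩ := (abSheaf M).existsUnique_gluing' W V (fun j => homOfLE (hW j)) hcov s
    (fun j j' => hs j j')
  exact ⟨t, ht⟩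

end MSections

/-! ## Restricting the cocycle identity -/

section Cocycle

variable {ι : Type v} (U : ι → X.Opens)

/-- The cocycle identity `c_{jk} - c_{ik} + c_{ij} = 0` of a Čech `1`-cocycle of `M`, restricted to any
open `W ⊆ U_i ∩ U_j ∩ U_k`. [folklore] -/
theorem cechMZ1.cocycle_res {c : CechMC1 f M U} (hc : c ∈ cechMZ1 f M U) (i j k : ι) {W : X.Opens}
    (hi : W ≤ U i) (hj : W ≤ U j) (hk : W ≤ U k) :
    MSections.res f M (le_inf hj hk) (c j k) - MSections.res f M (le_inf hi hk) (c i k) +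
      MSections.res f M (le_inf hi hj) (c i j) = 0 := by
  have h0 : cechMD1 f M U c i j k = 0 := by
    rw [(mem_cechMZ1_iff f M U c).mp hc]; rfl
  have h1 := congrArg (MSections.res f M (le_inf (le_inf hi hj) hk : W ≤ U i ⊓ U j ⊓ U k)) h0
  rw [cechMD1_apply, map_add, map_sub, map_zero, MSections.res_res, MSections.res_res,
    MSections.res_res] at h1
  exact h1

end Cocycle

/-! ## Refinement of families of opens and the induced maps on Čech cochains -/

section Refine

variable {ι : Type v} {ι' : Type w} (U : ι → X.Opens) (V : ι' → X.Opens) (τ : ι' → ι)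
  (hτ : ∀ j, V j ≤ U (τ j))

/-- Refinement on `0`-cochains: `(ρ b)_j = b_{τ j}|_{V_j}`.
[cite: GortzWedhorn2023, (21.16) Def. 21.71 (p. 262)] -/
def cechMRefineC0 : CechMC0 f M U →ₗ[A] CechMC0 f M V where
  toFun b j := MSections.res f M (hτ j) (b (τ j))
  map_add' b b' := by ext j; exact map_add _ (b (τ j)) (b' (τ j))
  map_smul' a b := by ext j; exact map_smul _ a (b (τ j))

/-- Refinement on `1`-cochains: `(ρ c)_{jj'} = c_{τ j, τ j'}|_{V_j ∩ V_{j'}}`.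
[cite: GortzWedhorn2023, (21.16) Def. 21.71 (p. 262)] -/
def cechMRefineC1 : CechMC1 f M U →ₗ[A] CechMC1 f M V where
  toFun c j j' := MSections.res f M (inf_le_inf (hτ j) (hτ j')) (c (τ j) (τ j'))
  map_add' c c' := by ext j j'; exact map_add _ (c (τ j) (τ j')) (c' (τ j) (τ j'))
  map_smul' a c := by ext j j'; exact map_smul _ a (c (τ j) (τ j'))

/-- Unfolding of `cechMRefineC0`. [folklore] -/
theorem cechMRefineC0_apply (b : CechMC0 f M U) (j : ι') :
    cechMRefineC0 f M U V τ hτ b j = MSections.res f M (hτ j) (b (τ j)) := rfl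

/-- Unfolding of `cechMRefineC1`. [folklore] -/
theorem cechMRefineC1_apply (c : CechMC1 f M U) (j j' : ι') :
    cechMRefineC1 f M U V τ hτ c j j' =
      MSections.res f M (inf_le_inf (hτ j) (hτ j')) (c (τ j) (τ j')) := rfl

/-- **Refinement commutes with `d⁰`.** [cite: GortzWedhorn2023, (21.16) (p. 262)] -/
theorem cechMD0_refineC0 (b : CechMC0 f M U) :
    cechMD0 f M V (cechMRefineC0 f M U V τ hτ b) = cechMRefineC1 f M U V τ hτ (cechMD0 f M U b) := by
  funext j j'
  simp only [cechMD0_apply, cechMRefineC0_apply, cechMRefineC1_apply, map_sub, MSections.res_res]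

/-- Refinement maps coboundaries to coboundaries. [folklore] -/
theorem refineMC1_mem_cechMB1 {c : CechMC1 f M U} (hc : c ∈ cechMB1 f M U) :
    cechMRefineC1 f M U V τ hτ c ∈ cechMB1 f M V := by
  rw [mem_cechMB1_iff] at hc ⊢
  obtain ⟨b, rfl⟩ := hc
  exact ⟨cechMRefineC0 f M U V τ hτ b, cechMD0_refineC0 f M U V τ hτ b⟩

/-- Refinement maps cocycles to cocycles (checked through the restricted cocycle identity).
[folklore] -/
theorem refineMC1_mem_cechMZ1 {c : CechMC1 f M U} (hc : c ∈ cechMZ1 f M U) :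
    cechMRefineC1 f M U V τ hτ c ∈ cechMZ1 f M V := by
  rw [mem_cechMZ1_iff]
  funext j j' j''
  rw [cechMD1_apply, cechMRefineC1_apply, cechMRefineC1_apply, cechMRefineC1_apply,
    MSections.res_res, MSections.res_res, MSections.res_res]
  exact cechMZ1.cocycle_res f M U hc (τ j) (τ j') (τ j'')
    ((inf_le_left.trans inf_le_left).trans (hτ j)) ((inf_le_left.trans inf_le_right).trans (hτ j'))
    (inf_le_right.trans (hτ j''))

/-! ## Injectivity of `Ȟ¹` under refinement -/

/-- **Cocycle form of the injectivity of `Ȟ¹(𝒰, M) → Ȟ¹(𝒱, M)`**: if `𝒱` covers every `U_i` and the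
refinement of a cocycle `c` of `M` on `𝒰` is a coboundary `d⁰e` on `𝒱`, then `c` is a coboundary on
`𝒰`: the sections `e_j + c_{τ j, i}` on `U_i ∩ V_j` agree on overlaps, glue to `b_i ∈ Γ(U_i, M)`, and
`d⁰ b = c` (checked locally on the `V_j`). [cite: GortzWedhorn2023, Cor. 21.81 (p. 265)] -/
theorem mem_cechMB1_of_refineMC1_mem_cechMB1 (hU : ∀ i, U i ≤ ⨆ j, V j) {c : CechMC1 f M U}
    (hc : c ∈ cechMZ1 f M U) (hρ : cechMRefineC1 f M U V τ hτ c ∈ cechMB1 f M V) :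
    c ∈ cechMB1 f M U := by
  obtain ⟨e, he⟩ := (mem_cechMB1_iff f M V _).mp hρ
  -- `he' j j'`: `e_{j'} - e_j = c_{τ j, τ j'}` on `V_j ∩ V_{j'}`
  have he' : ∀ j j', MSections.res f M inf_le_right (e j') - MSections.res f M inf_le_left (e j) =
      MSections.res f M (inf_le_inf (hτ j) (hτ j')) (c (τ j) (τ j')) := fun j j' => by
    rw [← cechMD0_apply, he]; rfl
  have hcov : ∀ i, U i ≤ ⨆ j, U i ⊓ V j := fun i => by
    rw [← inf_iSup_eq]; exact le_inf le_rfl (hU i)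
  -- local sections `s^i_j = e_j + c_{τ j, i}` on `U_i ∩ V_j`
  set s : ∀ i j, MSections f M (U i ⊓ V j) := fun i j =>
    MSections.res f M inf_le_right (e j) +
      MSections.res f M (le_inf (inf_le_right.trans (hτ j)) inf_le_left) (c (τ j) i) with hs
  have hglue : ∀ i j j',
      MSections.res f M (inf_le_left : (U i ⊓ V j) ⊓ (U i ⊓ V j') ≤ _) (s i j) =
      MSections.res f M (inf_le_right : (U i ⊓ V j) ⊓ (U i ⊓ V j') ≤ _) (s i j') := by
    intro i j j'
    simp only [hs, map_add, MSections.res_res]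
    have hWi : (U i ⊓ V j) ⊓ (U i ⊓ V j') ≤ U i := inf_le_left.trans inf_le_left
    have hWj : (U i ⊓ V j) ⊓ (U i ⊓ V j') ≤ V j := inf_le_left.trans inf_le_right
    have hWj' : (U i ⊓ V j) ⊓ (U i ⊓ V j') ≤ V j' := inf_le_right.trans inf_le_right
    have h1 := cechMZ1.cocycle_res f M U hc (τ j) (τ j') i (hWj.trans (hτ j)) (hWj'.trans (hτ j'))
      hWi
    have h2 := congrArg (MSections.res f M (le_inf hWj hWj' : _ ≤ V j ⊓ V j')) (he' j j')
    rw [map_sub, MSections.res_res, MSections.res_res, MSections.res_res] at h2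
    -- `e_j + c_{τj,i} = e_{j'} + c_{τj',i}` iff `c_{τj',i} - c_{τj,i} = e_j - e_{j'} = -c_{τj,τj'}`
    rw [← sub_eq_zero]
    rw [← sub_eq_zero] at h2
    have key : ∀ (Ej Ej' Cji Cj'i Cjj' : MSections f M ((U i ⊓ V j) ⊓ (U i ⊓ V j'))),
        Cj'i - Cji + Cjj' = 0 → Ej' - Ej - Cjj' = 0 → Ej + Cji - (Ej' + Cj'i) = 0 := by
      intro Ej Ej' Cji Cj'i Cjj' h1 h2
      have : Ej + Cji - (Ej' + Cj'i) = -(Cj'i - Cji + Cjj') - (Ej' - Ej - Cjj') := by abel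
      rw [this, h1, h2, neg_zero, sub_zero]
    exact key _ _ _ _ _ h1 h2
  choose b hb using fun i => MSections.exists_res_eq f M (fun j => U i ⊓ V j) (fun j => inf_le_left)
    (hcov i) (s i) (hglue i)
  refine (mem_cechMB1_iff f M U c).mpr ⟨b, ?_⟩
  funext i i'
  -- check `b_{i'} - b_i = c_{i i'}` on `U_i ∩ U_{i'}` locally on the `V_j`
  apply MSections.eq_of_res_eq f M (fun j => (U i ⊓ U i') ⊓ V j) (fun j => inf_le_left)
  · rw [← inf_iSup_eq]; exact le_inf le_rfl (inf_le_left.trans (hU i))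
  intro j
  have hWi : (U i ⊓ U i') ⊓ V j ≤ U i := inf_le_left.trans inf_le_left
  have hWi' : (U i ⊓ U i') ⊓ V j ≤ U i' := inf_le_left.trans inf_le_right
  have hWj : (U i ⊓ U i') ⊓ V j ≤ V j := inf_le_right
  have hbi := congrArg (MSections.res f M (le_inf hWi hWj : _ ≤ U i ⊓ V j)) (hb i j)
  have hbi' := congrArg (MSections.res f M (le_inf hWi' hWj : _ ≤ U i' ⊓ V j)) (hb i' j)
  simp only [hs, map_add, MSections.res_res] at hbi hbi'
  rw [cechMD0_apply, map_sub, MSections.res_res, MSections.res_res]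
  erw [hbi, hbi']
  have h1 := cechMZ1.cocycle_res f M U hc (τ j) i i' (hWj.trans (hτ j)) hWi hWi'
  have key : ∀ (Ej Cji Cji' Cii' : MSections f M ((U i ⊓ U i') ⊓ V j)),
      Cii' - Cji' + Cji = 0 → Ej + Cji' - (Ej + Cji) = Cii' := by
    intro Ej Cji Cji' Cii' h
    have : Ej + Cji' - (Ej + Cji) = Cii' - (Cii' - Cji' + Cji) := by abel
    rw [this, h, sub_zero]
  exact key _ _ _ _ h1

end Refine

end Literature.AlgebraicGeometry.Morphisms

end
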